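import Summits.Schanuel.Schanuel.Theorems.RootDecomp1BMovingZero20

/-!
# RootDecomp1BMovingZero — lens 4, generation 39 «ISOLATED POINT BOUND, SLOT DISCHARGED» (lane B-R24 (a) / RULE B-R25): the last B-side print input `IsolatedPointBound` (FACT B, part 11) of the moving-zero cell DISCHARGED up to its parameter-free numeral — `def IsolatedPointBoundN` (part 11's text with `(2n+3)·log(n+1) ↦ 6n³`) and `theorem isolatedPointBoundN_holds : IsolatedPointBoundN` HYPOTHESIS-FREE from the tree's proved Nesterenko–Philippon elimination theory; `ApproxOfIsolated ρ` UNCONDITIONAL for every real ρ; `MovingZeroApprox ρ` modulo `AxRankBoundLaurent` only; the (1|ρ) storey cell modulo {Ax, LWMeasure, ExplicitRatExpApprox} — continuation (RootDecomp1BMovingZero21): §N `def IsolatedPointBoundN`, (γ), THE DISCHARGE `isolatedPointBoundN_holds`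

(lens-4 g39 HOME kernel IsolatedPointDischarge.lean dce96aa4…, 1262 l, imports tree MovingZero17 + the Literature elimination theory (PhilipponCriterionDescend / ProjectiveNoIsolatedPoints / NesterenkoEliminationProp411Holds / Prop47Holds / Facts2Proofs / NesterenkoUResultantIntCoeffs / NesterenkoIntegerHeights / PhilipponCriterionRankOne / ConeRank / Principal / NesterenkoEliminationZeros) + Mathlib MahlerMeasure; CLAIM L2051, RULING + RULE B-R25 + CHECKLIST B-g39 L2053, NODE L2060 / REQUEST L2061 / RESULT L2062, critic VERDICT L2063 (crit g8: CLEARED — THEOREM ×1 for the SLOT under RULE B-R25; lens-4 tally THEOREM ×6 + CELL ×2; the moving-zero cell's named inputs of record = {AxRankBoundLaurent, LWMeasure, ExplicitRatExpApprox}; PORT GO); port by census-1 gen 18 as `RootDecomp1BMovingZero18`–`22`: 18 = `namespace IsolatedPt` §E1–§E3 (binary forms at `(1,t)`, algebraicity of the coordinates on a rank-one prime, no point at infinity); 19 = §E4a the `u`-resultant read on the lines `τ e₀ − e_{j+1}` (`zpart` / `gPoly` / `uVec` / `pairExp`, coefficient and degree lemmas); 20 = §E4b the rank-one endgame `IsolatedPt.exists_poly_of_rank_one`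 (integer Chow form + Mahler measure) + §D the TRACKED DESCENT `IsolatedPt.descent_tracked` + §A arithmetic (`log_mvPolyHeight_le`, `junk_absorb`, `sharp_le_junk`); 21 = §N `def IsolatedPointBoundN`, (γ) `isolatedPointBoundN_of_isolatedPointBound`, THE DISCHARGE `isolatedPointBoundN_holds` (kind definition, `--no-relocate`); 22 = §B consumers re-run (`isolatedPointBoundN_five`, `height_side_leN`, `approxOfIsolated_of_factsN`, `movingZeroApprox_of_factsN`, `approxOfIsolated_holds`, `approxOfIsolated_of_ax`, `movingZeroApprox_of_ax`) + the four cells `four_le_polarDeg_one/swap/one_hyper/one_rhoT_of_ax`.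
PORT EDITS: the `AxiomGuards` section (7 `#guard_msgs in #print axioms`), the unused `import HarnessLib` and `set_option linter.dupNamespace false` dropped; eleven one-line docstrings added; statements and proofs verbatim. `--supports stmt-Schanuel-24622`; no census credit carried; rung 0 — nothing here proves Schanuel.)
-/

noncomputable section

attribute [local instance] MvPolynomial.gradedAlgebra

open MvPolynomial
open Literature.NumberTheory.Transcendental
open Literature.NumberTheory.Transcendental.Nesterenko
open Literature.NumberTheory.Transcendental.PhilipponMain

namespace Summit.Schanuel.Schanuel.Theorems.RootDecomp1BMovingZero

/-! ## §N  The isolated-point bound with the elimination-theoretic numeral `6 n³`, PROVED -/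

section IsolatedPointBoundN

open Filter Topology Polynomial

/-- `IsolatedPointBound` (part 11, l.82) VERBATIM except for the absolute numeral: the sharp
`(2 * n + 3) * Real.log ((n : ℝ) + 1)` (arithmetic Bézout of Krick–Pardo–Sombra 2001, Cor. 2.10 — not
in the tree) is replaced by `6 * (n : ℝ) ^ 3`, the constant delivered by the tree's Nesterenko–Philippon
elimination theory (LNM 1752 Ch. 3, Props. 4.7, 4.8, 4.11 with their `m² d`, `m² deg`, `m (r+1) deg d`
terms).  Same binders, same quantifier order, same `∏ Dᵢ` and `n · log H` terms.  The sharp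
`IsolatedPointBound` stays typed in part 11 and is NOT load-bearing for any consumer of record (every
consumer only uses the shape `(∏ Dᵢ) · (n log H + c(n))`); its KPS numeral remains open in the tree.
[cite: NesterenkoPhilippon2001, Ch. 3 Props. 4.7, 4.8, 4.11 (pp. 39–41)] -/
def IsolatedPointBoundN : Prop :=
  ∀ (s n : ℕ) (F : Fin s → MvPolynomial (Fin n) ℤ) (D : Fin s → ℕ) (H : ℕ) (ω : Fin n → ℂ),
    (∀ i, 1 ≤ D i) → (∀ i, (F i).totalDegree ≤ D i) → 1 ≤ H → (∀ i m, |(F i).coeff m| ≤ (H : ℤ)) →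
      (∀ i, MvPolynomial.aeval ω (F i) = 0) → (∀ᶠ ω' in 𝓝[≠] ω, ∃ i, MvPolynomial.aeval ω' (F i) ≠ 0) →
        ∀ j : Fin n, ∃ Q : ℤ[X], Irreducible Q ∧ 0 < Q.natDegree ∧ Polynomial.aeval (ω j) Q = 0 ∧
          (Q.natDegree : ℝ) ≤ ∏ i, (D i : ℝ) ∧
            Real.log (Q.map (Int.castRingHom ℂ)).mahlerMeasure ≤
              (∏ i, (D i : ℝ)) * ((n : ℝ) * Real.log H + 6 * (n : ℝ) ^ 3)

/-- (γ) «same statement, weaker constant»: the sharp FACT B implies the `6 n³` version. -/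
theorem isolatedPointBoundN_of_isolatedPointBound (hB : IsolatedPointBound) : IsolatedPointBoundN := by
  intro s n F D H ω hD hdeg hH hcoeff hzero hiso j
  obtain ⟨Q, h1, h2, h3, h4, h5⟩ := hB s n F D H ω hD hdeg hH hcoeff hzero hiso j
  refine ⟨Q, h1, h2, h3, h4, h5.trans ?_⟩
  have hP : 0 ≤ ∏ i, (D i : ℝ) := Finset.prod_nonneg fun i _ => Nat.cast_nonneg _
  exact mul_le_mul_of_nonneg_left (by linarith [IsolatedPt.sharp_le_junk n]) hP

open IsolatedPt in
/-- **`IsolatedPointBoundN` holds** — hypothesis-free, from the tree's PROVED elimination theory: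
W1 `exists_not_mem_of_finite_zeros` (no Euclidean-isolated projective zero in rank `≥ 2`, tree) feeds
W2 the tracked descent `IsolatedPt.descent_tracked` (Props. 4.7/4.8/4.11, tree theorems
`NesterenkoPhilippon2001_ch3_prop_4_7_holds` / `_4_8_holds` / `_4_11_holds`) from a component of the
hypersurface `(E_{i₀})` through `(1 : ω)` down to a rank-one homogeneous prime `𝔔 ∋ (1 : ω)` with
`deg 𝔔 ≤ ∏_{used} deg Fᵢ ≤ ∏ Dᵢ`, `h(𝔔) ≤ (∏ Dᵢ)(n log H + 6n³ - 1)`; W3 `IsolatedPt.exists_poly_of_rank_one`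
(no point of `V(𝔔)` at infinity since the `ω_j` are algebraic by `trdeg = rank - 1 = 0`; the
`u`-resultant = integer Chow form of `𝔔` specialised at `u = (τ, 0, …, -1_j, …, 0)` is a non-zero
integer polynomial of degree `≤ deg 𝔔` vanishing at `ω_j`, of Mahler measure `≤ exp(h(𝔔) + deg 𝔔)`,
and so is its irreducible factor through `ω_j`). -/
theorem isolatedPointBoundN_holds : IsolatedPointBoundN := by
  intro s n F D H ω hD1 hdeg hH1 hcoef hzero hisol j
  classical
  have hn : 1 ≤ n := Fin.pos j
  haveI : Nonempty (Fin n) := ⟨j⟩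
  -- homogenisation of the integer system
  choose E hE using fun i => PhilipponMain.exists_homogenization (F i)
  set d : Fin s → ℕ := fun i => (F i).totalDegree with hd
  have hEhom : ∀ i, (E i).IsHomogeneous (d i) := fun i => (hE i).1
  have hsucc : ∀ z : Fin n → ℂ, (fun k : Fin n => (Fin.cons 1 z : Fin (n + 1) → ℂ) k.succ) = z :=
    fun z => funext fun k => Fin.cons_succ _ _ _
  have haevalE : ∀ (z : Fin n → ℂ) (i : Fin s),
      aeval (Fin.cons 1 z : Fin (n + 1) → ℂ) (E i) = MvPolynomial.aeval z (F i) := fun z i => by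
    rw [(hE i).2.1 _ (Fin.cons_zero _ _), hsucc]
  have hzE : ∀ i, aeval (Fin.cons 1 ω : Fin (n + 1) → ℂ) (E i) = 0 := fun i => by
    rw [haevalE, hzero]
  have hlogH : 0 ≤ Real.log H := Real.log_nonneg (by exact_mod_cast hH1)
  have hhE : ∀ i, height (E i) ≤ Real.log H := fun i =>
    (hE i).2.2.2.1.trans (log_mvPolyHeight_le hH1 (hcoef i))
  -- Euclidean isolation ⇒ the common zeros in a closed polydisc about `ω` form a finite set (`⊆ {ω}`)
  obtain ⟨ρ₀, hρ₀, hfin⟩ : ∃ ρ₀ : ℝ, 0 < ρ₀ ∧ Set.Finite {z : Fin n → ℂ | (∀ i, ‖z i - ω i‖ ≤ ρ₀) ∧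
      ∀ l, aeval (Fin.cons 1 z : Fin (n + 1) → ℂ) (E l) = 0} := by
    obtain ⟨ε, hε, hball⟩ := Metric.eventually_nhds_iff.mp (eventually_nhdsWithin_iff.mp hisol)
    refine ⟨ε / 2, by positivity, (Set.finite_singleton ω).subset ?_⟩
    rintro z ⟨hzρ, hzl⟩
    by_contra hne
    have hdist : dist z ω < ε := by
      refine lt_of_le_of_lt ((dist_pi_le_iff (by positivity)).mpr fun k => ?_) (half_lt_self hε)
      rw [dist_eq_norm]; exact hzρ k
    obtain ⟨i, hi⟩ := hball hdist hne
    exact hi (by rw [← haevalE]; exact hzl i)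
  -- a non-zero equation (there is one: `𝓝[≠] ω` is non-trivial in `ℂⁿ`, `n ≥ 1`)
  obtain ⟨i₀, hi₀⟩ : ∃ i₀, F i₀ ≠ 0 := by
    by_contra hall
    push Not at hall
    haveI : (𝓝[≠] ω).NeBot := Module.punctured_nhds_neBot ℂ (Fin n → ℂ) ω
    obtain ⟨ω', i, hi⟩ := hisol.exists
    exact hi (by rw [hall i, map_zero])
  have hE₀ne : E i₀ ≠ 0 := (hE i₀).2.2.2.2 hi₀
  -- it is non-constant (it vanishes at `ω`)
  have hd₀ : 1 ≤ d i₀ := by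
    by_contra h0
    have h00 : (F i₀).totalDegree = 0 := by
      have : d i₀ = (F i₀).totalDegree := rfl
      omega
    have hFC : F i₀ = MvPolynomial.C ((F i₀).coeff 0) := MvPolynomial.totalDegree_eq_zero_iff_eq_C.mp h00
    have h2 : (((F i₀).coeff 0 : ℤ) : ℂ) = 0 := by
      have := hzero i₀
      rwa [hFC, MvPolynomial.aeval_C, eq_intCast] at this
    exact hi₀ (by rw [hFC, Int.cast_eq_zero.mp h2, MvPolynomial.C_0])
  have hEunit : ¬ IsUnit (E i₀) := by
    intro hu
    have h0 := (MvPolynomial.isUnit_iff_totalDegree_of_isReduced.mp hu).2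
    rw [(hEhom i₀).totalDegree hE₀ne] at h0
    omega
  -- the hypersurface `(E i₀)` and its component through `(1 : ω)`
  set I₀ : Ideal (Rx n) := Ideal.span {E i₀} with hI₀
  have hI₀unm : IsUnmixedOfRank I₀ n := isUnmixedOfRank_span_singleton hE₀ne hEunit
  have hI₀hom : I₀.IsHomogeneous (homogeneousSubmodule (Fin (n + 1)) ℚ) :=
    Ideal.homogeneous_span _ _ fun x hx => ⟨d i₀, by rw [Set.mem_singleton_iff.mp hx]; exact hEhom i₀⟩
  obtain ⟨t₀, ht₀⟩ : ∃ t₀ : Finset (Ideal (Rx n)), Submodule.IsMinimalPrimaryDecomposition I₀ t₀ :=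
    Submodule.IsLasker.exists_isMinimalPrimaryDecomposition (Submodule.isLasker (Rx n) (Rx n)) I₀
  have hωb0 : (Fin.cons 1 ω : Fin (n + 1) → ℂ) ≠ 0 := cons_one_ne_zero ω
  have hωI₀ : (Fin.cons 1 ω : Fin (n + 1) → ℂ) ∈ projZeros I₀ := by
    rw [hI₀, projZeros_span_singleton]; exact ⟨hωb0, hzE i₀⟩
  have hωU : (Fin.cons 1 ω : Fin (n + 1) → ℂ) ∈ ⋃ Q ∈ t₀, projZeros Q.radical := by
    rw [← projZeros_eq_biUnion_radical ht₀.inf_eq]; exact hωI₀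
  obtain ⟨Q₀, hQ₀, hωQ₀⟩ := Set.mem_iUnion₂.mp hωU
  obtain ⟨h𝔓₀, h𝔓₀hom, h𝔓₀unm, -, -⟩ :=
    Literature.Barriers.Schanuel.radical_component_facts hI₀hom hI₀unm ht₀ hQ₀
  have hk : ∀ Q ∈ t₀, 1 ≤ primaryExponent Q := fun Q hQ =>
    (Literature.Barriers.Schanuel.radical_component_facts hI₀hom hI₀unm ht₀ hQ).2.2.2.2
  have hI₀Q₀ : I₀ ≤ Q₀ := by
    have h := Finset.inf_le (f := id) hQ₀
    rwa [ht₀.inf_eq] at h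
  have hEQ₀ : E i₀ ∈ Q₀.radical := Ideal.le_radical (hI₀Q₀ (Ideal.subset_span rfl))
  -- Props. 4.8 / 4.7 (tree theorems): degree and height of the starting component
  have h48 := NesterenkoPhilippon2001_ch3_prop_4_8_holds n (E i₀) (d i₀) hn hE₀ne (hEhom i₀) hI₀unm _ hωb0
  have h47 := NesterenkoPhilippon2001_ch3_prop_4_7_holds n n I₀ hn le_rfl hI₀hom hI₀unm t₀ ht₀ _ hωb0
  have hdeg𝔓₀ : (ideg Q₀.radical n : ℝ) ≤ ∏ l ∈ ({i₀} : Finset (Fin s)), (d l : ℝ) := by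
    rw [Finset.prod_singleton]
    exact_mod_cast (ideg_radical_le h47.1 hk hQ₀).trans h48.1.le
  have hh𝔓₀ : iheight Q₀.radical n ≤
      (∏ l ∈ ({i₀} : Finset (Fin s)), (d l : ℝ)) * (Real.log H + 2 * (n : ℝ) ^ 2) := by
    rw [Finset.prod_singleton]
    have h1 := iheight_radical_le h47.2.1 hk hQ₀
    rw [h48.1] at h1
    have h2 := h48.2.1
    have h3 := hhE i₀
    have hd1 : (1 : ℝ) ≤ d i₀ := by exact_mod_cast hd₀
    have h4 : Real.log H ≤ (d i₀ : ℝ) * Real.log H := by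
      nlinarith [mul_nonneg (sub_nonneg.mpr hd1) hlogH]
    nlinarith
  -- W1 + W2: the tracked descent to rank one
  obtain ⟨𝔔, S, h𝔔, h𝔔hom, h𝔔unm, hω𝔔, -, hdegS, hhS⟩ :=
    descent_tracked NesterenkoPhilippon2001_ch3_prop_4_7_holds
      NesterenkoPhilippon2001_ch3_prop_4_11_holds hn le_rfl h𝔓₀ h𝔓₀hom h𝔓₀unm ω hρ₀ E d hEhom
      hlogH (by positivity) hhE hfin hωQ₀ (fun i => by simp [hρ₀]) hzE {i₀}
      (fun l hl => by rw [Finset.mem_singleton.mp hl]; exact hEQ₀) hdeg𝔓₀ hh𝔓₀ (n - 1) (by omega)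
  have hr1 : n - (n - 1) = 1 := by omega
  rw [hr1] at h𝔔unm hdegS hhS
  -- W3: the rank-one endgame
  obtain ⟨Q, hQirr, hQpos, hQz, hQdeg, hQM⟩ := exists_poly_of_rank_one h𝔔 h𝔔hom h𝔔unm hω𝔔 j
  -- `∏_{used} deg Fᵢ ≤ ∏ Dᵢ`
  have hPS0 : 0 ≤ ∏ l ∈ S, (d l : ℝ) := Finset.prod_nonneg fun l _ => Nat.cast_nonneg _
  have hPS : (∏ l ∈ S, (d l : ℝ)) ≤ ∏ i, (D i : ℝ) := by
    calc (∏ l ∈ S, (d l : ℝ)) ≤ ∏ l ∈ S, (D l : ℝ) :=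
          Finset.prod_le_prod (fun l _ => Nat.cast_nonneg _) (fun l _ => by exact_mod_cast hdeg l)
      _ ≤ ∏ i, (D i : ℝ) := by
          have h : ∏ l ∈ S, D l ≤ ∏ i, D i :=
            Finset.prod_le_prod_of_subset_of_one_le' (Finset.subset_univ S) fun i _ _ => hD1 i
          exact_mod_cast h
  have hPD0 : 0 ≤ ∏ i, (D i : ℝ) := Finset.prod_nonneg fun i _ => Nat.cast_nonneg _
  refine ⟨Q, hQirr, hQpos, hQz, ?_, ?_⟩
  · have h1 : (Q.natDegree : ℝ) ≤ ideg 𝔔 1 := by exact_mod_cast hQdeg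
    exact h1.trans (hdegS.trans hPS)
  · have hcast : ((n - 1 : ℕ) : ℝ) = (n : ℝ) - 1 := by rw [Nat.cast_sub hn, Nat.cast_one]
    rw [hcast] at hhS
    have hn1 : (0 : ℝ) ≤ (n : ℝ) - 1 := by
      have : (1 : ℝ) ≤ n := by exact_mod_cast hn
      linarith
    have hB0 : 0 ≤ Real.log H + 2 * (n : ℝ) ^ 2 +
        ((n : ℝ) - 1) * (Real.log H + ((n : ℝ) * (n + 1) + (n : ℝ) ^ 2)) + 1 :=
      add_nonneg (add_nonneg (by positivity) (mul_nonneg hn1 (by positivity))) zero_le_one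
    calc Real.log (Q.map (Int.castRingHom ℂ)).mahlerMeasure ≤ iheight 𝔔 1 + ideg 𝔔 1 := hQM
      _ ≤ (∏ l ∈ S, (d l : ℝ)) * (Real.log H + 2 * (n : ℝ) ^ 2 +
            ((n : ℝ) - 1) * (Real.log H + ((n : ℝ) * (n + 1) + (n : ℝ) ^ 2))) +
            ∏ l ∈ S, (d l : ℝ) := add_le_add hhS hdegS
      _ = (∏ l ∈ S, (d l : ℝ)) * (Real.log H + 2 * (n : ℝ) ^ 2 +
            ((n : ℝ) - 1) * (Real.log H + ((n : ℝ) * (n + 1) + (n : ℝ) ^ 2)) + 1) := by ring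
      _ ≤ (∏ i, (D i : ℝ)) * ((n : ℝ) * Real.log H + 6 * (n : ℝ) ^ 3) :=
          mul_le_mul hPS (junk_absorb hn _) hB0 hPD0

end IsolatedPointBoundN

end Summit.Schanuel.Schanuel.Theorems.RootDecomp1BMovingZero

end
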